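import Summits.QuantumFields.BalabanUV.T4Continuum.Support.ScalarBlockPlanting

/-!
# T⁴ programme, spine node NE2 (U1a), tier B support row B4.d — THE UNIT-BLOCK MASS INTERTWINES EXACTLY WITH KING'S 0-FORM PLANTING
# (`Π′_{RN} = J₀ Π′_N J₀ᴴ`, `Δ′_{RN} = Δ_{RN} + J₀(a′Π′_N)J₀ᴴ`) and THE COMPLEMENT DEFECT `‖G′_{RN}(1 − J₀J₀ᴴ)‖ ≤ 2d·√(γ′⁻¹)/N`
# (file 4 of row B4.d)

NE2 formalisation swarm `b2b-balaban-t4-ne2-formalise-*`, seat LEAF PROVER 04, support row B4.d of `t4/formal/NE2/LEAVES.md` («U = 1 scalar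
free-tower laws against King's pairing»).  Companion of `Support/ScalarBlockPlanting` (the 0-form planting `JK0 = √(R^d)·Q₀ᴴ`, `Π₀ = J₀J₀ᴴ`
and its one-step block Poincaré inequality).  With row B4.c's `U = 1` scalar operator `DeltaPs n M a′ = LapS + a′•PiS n M`
(`Support/ScalarAveragedPropagator`; [Balaban1985BackgroundPropagators] (3.24) p.394 at `U = 1`) this file proves:

 * §1 **THE UNIT-BLOCK MASS INTERTWINES EXACTLY**: `val_blockOf`, `blockOf_par` (`blockOf_{RN} x = blockOf_N (par x)`: the unit block of
   a fine site is the unit block of its parent), `PiS_apply` (`Π′_n(x, x′) = n^{−d}·[same unit block]`),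
   `JK0_mul_mul_JK0H_apply` (`(J₀ A J₀ᴴ)(x, x′) = R^{−d}·A(par x, par x′)`), **`PiS_eq_sandwich : PiS (R·N) M = JK0 · PiS N M · JK0ᴴ`**,
   `PiS_mul_JK0`, and **`DeltaPs_eq_sandwich : DeltaPs (R·N) M a′ = LapS + JK0 · (a′•PiS N M) · JK0ᴴ`** — the `A + J B Jᴴ` form
   consumed by the exact sandwich identity `Support/OneStepEffectiveOperator.sandwich_inv_eq` (file 1 of the row): averaging-and-planting
   the level-`(k+1)` scalar propagator gives EXACTLY the level-`k` propagator of the effective Laplacian;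
 * §2 **THE COMPLEMENT DEFECT** `‖G′_{RN}·(1 − J₀J₀ᴴ)‖ ≤ 2d·√(γ′⁻¹)/N` (the 0-form Poincaré inequality of the companion file + B4.c's
   `‖∂_νG′‖ ≤ √(γ′⁻¹)`) — the field `FreeTowerLaws.complement_le` of the scalar tower, rate `L^{−k}`;
 * §3 the tower-level names `Q0lev`, `J0pcT` (`J₀ᴴJ₀ = 1`, `‖J₀‖ ≤ 1`, `‖Q₀‖² ≤ L^{−d}`, pairing `√(L^d)·Q₀J₀ = 1 + 0`), `DeltaPs_succ_eq`,
   `PiS_succ_mul_J0pcT`, **`complement_le_lev0`**.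

HONEST FRAMING (T4-DAG p. 1).  `U = 1`, finite torus, scalar (0-form) layer, operator norm; exact lattice bookkeeping + one inequality;
statements / constants OURS ([folklore]); a SUPPORT input of row B4.b, NOT B4, NOT [Balaban1985BackgroundPropagators] (3.23)–(3.26) as
printed; NE2 NOT proved; NOT infinite volume / mass gap / Clay / summit progress; spine 0/9 unchanged.  HONEST DEPENDENCY: continuum YM on
T⁴ ⇐ BetaPertH ∧ nine spine estimates (0/9 proved); BetaPertH ⇐ (D1) ∧ (D4) ∧ CAP+tail; G-an2-4 gates asym, D1 and NE2/3/4.  ABSOLUTE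
RULE kept; no `sorry`.
-/

noncomputable section

open scoped BigOperators ComplexConjugate Matrix Matrix.Norms.L2Operator

namespace Summit.QuantumFields.BalabanUV.T4Continuum.ScalarPlantingDefect

open Literature.MathematicalPhysics.QuantumFieldTheory.Balaban1983to89.B5Prop11Plancherel
open Literature.MathematicalPhysics.QuantumFieldTheory.Balaban1983to89.B5Action121 (shiftS sdiff LapS)
open Literature.MathematicalPhysics.QuantumFieldTheory.Balaban1983to89.B5Block118 (QsOp bpt)
open Literature.MathematicalPhysics.QuantumFieldTheory.Balaban1983to89.B5Blocks16 (blockOf bpt_val bpt_bijective)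
open Literature.MathematicalPhysics.QuantumFieldTheory.Balaban1983to89.B5G183RateUnitTower (lev lev_neZero)
open Summit.QuantumFields.BalabanUV.T4Continuum
open Summit.QuantumFields.BalabanUV.T4Continuum.BalabanAveragedTowerUnit (idx lev_succ' one_le_lev' cast_lev')
open Summit.QuantumFields.BalabanUV.T4Continuum.BalabanAveragedTowerModes (par val_par)
open Summit.QuantumFields.BalabanUV.T4Continuum.KingPairingPlantedLaw (sqrt_facts)
open Summit.QuantumFields.BalabanUV.T4Continuum.ScalarBlockPoincare (PiS)
open Summit.QuantumFields.BalabanUV.T4Continuum.ScalarAveragedPropagator (DeltaPs gammaPs Gps gammaPs_pos Gps_isHermitian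
  opNorm_sdiff_mul_Gps_le)
open Summit.QuantumFields.BalabanUV.T4Continuum.ScalarBlockPlanting

variable {d : ℕ}

section TwoLevel

variable (N R : ℕ) [NeZero N] [NeZero R] (M : Fin d → ℕ) [hM : ∀ μ, NeZero (M μ)]

omit [NeZero N] [NeZero R] hM in
/-- `√(R^d)` facts. [folklore] -/
private theorem sqrtR : star ((((Real.sqrt ((R : ℝ) ^ d)) : ℝ) : ℂ)) = (((Real.sqrt ((R : ℝ) ^ d)) : ℝ) : ℂ) ∧
    ((((Real.sqrt ((R : ℝ) ^ d)) : ℝ) : ℂ)) * (((Real.sqrt ((R : ℝ) ^ d)) : ℝ) : ℂ) = (R : ℂ) ^ d := sqrt_facts (d := d) R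

/-! ## §1 The unit-block mass intertwines exactly -/

omit [NeZero N] [NeZero R] in
/-- the block of a fine site has coordinates `⌊x_ν/n⌋`. [folklore] -/
theorem val_blockOf (n : ℕ) [NeZero n] (x : Tor (fine n M)) (ν : Fin d) : (blockOf n M x ν).val = (x ν).val / n := by
  have hn : 0 < n := Nat.pos_of_ne_zero (NeZero.ne n)
  set e := Equiv.ofBijective _ (bpt_bijective n M) with he
  have hx : x = bpt n M (e.symm x).1 (e.symm x).2 := (e.apply_symm_apply x).symm
  have hblk : blockOf n M x = (e.symm x).1 := rfl
  rw [hblk]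
  conv_rhs => rw [hx, bpt_val]
  rw [Nat.mul_add_div hn, Nat.div_eq_of_lt ((e.symm x).2 ν).isLt, add_zero]

/-- **`blockOf_{RN} x = blockOf_N (par x)`**: the unit block of a fine site is the unit block of its parent. [folklore] -/
theorem blockOf_par (x : Tor (fine (R * N) M)) : blockOf N M (par N R M x) = blockOf (R * N) M x := by
  funext ν
  apply ZMod.val_injective
  rw [val_blockOf, val_par, val_blockOf, Nat.div_div_eq_div_mul]

/-- the entries of `Π′_n = n^d Q′ᴴQ′`: `n^{−d}·[same unit block]`. [folklore] -/
theorem PiS_apply (n : ℕ) [NeZero n] (x x' : Tor (fine n M)) :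
    PiS n M x x' = if blockOf n M x = blockOf n M x' then ((n : ℂ) ^ d)⁻¹ else 0 := by
  have hn : ((n : ℂ) ^ d) ≠ 0 := pow_ne_zero _ (by exact_mod_cast NeZero.ne n)
  rw [PiS, Matrix.smul_apply, smul_eq_mul, Matrix.mul_apply]
  simp only [Matrix.conjTranspose_apply, ScalarBlockPoincare.QsOp_apply_blockOf, apply_ite star, star_zero, star_div₀, star_one, star_pow,
    star_natCast, ite_mul, zero_mul, mul_ite, mul_zero]
  rw [Finset.sum_ite_eq Finset.univ (blockOf n M x')]
  simp only [Finset.mem_univ, if_true]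
  by_cases h : blockOf n M x = blockOf n M x'
  · simp only [h, if_true]; field_simp
  · simp [h]

omit [NeZero R] in
/-- columns of `A Q₀`: `(A Q₀)(y, x′) = R^{−d}·A(y, par x′)`. [folklore] -/
theorem mul_Qavg0_apply {α : Type*} (A : Matrix α (Tor (fine N M)) ℂ) (y : α) (x' : Tor (fine (R * N) M)) :
    (A * Qavg0 N R M) y x' = ((R : ℂ) ^ d)⁻¹ * A y (par N R M x') := by
  simp only [Matrix.mul_apply, Qavg0, mul_ite, mul_zero]
  rw [Finset.sum_ite_eq Finset.univ (par N R M x')]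
  simp [mul_comm]

/-- **`(J₀ A J₀ᴴ)(x, x′) = R^{−d}·A(par x, par x′)`**. [folklore] -/
theorem JK0_mul_mul_JK0H_apply (A : Matrix (Tor (fine N M)) (Tor (fine N M)) ℂ) (x x' : Tor (fine (R * N) M)) :
    (JK0 N R M * A * (JK0 N R M)ᴴ) x x' = ((R : ℂ) ^ d)⁻¹ * A (par N R M x) (par N R M x') := by
  have hRc : ((R : ℂ) ^ d) ≠ 0 := pow_ne_zero _ (by exact_mod_cast NeZero.ne R)
  obtain ⟨hs, hss⟩ := sqrtR (d := d) R
  have e : JK0 N R M * A * (JK0 N R M)ᴴ = ((R : ℂ) ^ d) • ((Qavg0 N R M)ᴴ * (A * Qavg0 N R M)) := by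
    rw [JK0, Matrix.conjTranspose_smul, Matrix.conjTranspose_conjTranspose, hs, Matrix.smul_mul, Matrix.smul_mul, Matrix.mul_smul,
      smul_smul, hss, Matrix.mul_assoc]
  rw [e, Matrix.smul_apply, smul_eq_mul, Qavg0_conjTranspose_mul_apply, mul_Qavg0_apply, ← mul_assoc, mul_inv_cancel₀ hRc, one_mul]

/-- **THE UNIT-BLOCK MASS INTERTWINES EXACTLY**: `Π′_{RN} = J₀ Π′_N J₀ᴴ`. [folklore] -/
theorem PiS_eq_sandwich : PiS (R * N) M = JK0 N R M * PiS N M * (JK0 N R M)ᴴ := by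
  ext x x'
  rw [JK0_mul_mul_JK0H_apply, PiS_apply, PiS_apply, blockOf_par, blockOf_par]
  split_ifs with h
  · push_cast; rw [mul_pow, mul_inv]
  · rw [mul_zero]

/-- `Π′_{RN} J₀ = J₀ Π′_N`. [folklore] -/
theorem PiS_mul_JK0 : PiS (R * N) M * JK0 N R M = JK0 N R M * PiS N M := by
  rw [PiS_eq_sandwich, Matrix.mul_assoc, JK0_conjTranspose_mul_JK0, Matrix.mul_one]

/-- **`Δ′_{RN} = Δ_{RN} + J₀ (a′•Π′_N) J₀ᴴ`** — the `A + JBJᴴ` form of the next level's scalar operator. [folklore] -/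
theorem DeltaPs_eq_sandwich (a' : ℝ) :
    DeltaPs (R * N) M a' = LapS (fine (R * N) M) ((R * N : ℕ) : ℂ) + JK0 N R M * ((a' : ℂ) • PiS N M) * (JK0 N R M)ᴴ := by
  rw [DeltaPs, Matrix.mul_smul, Matrix.smul_mul, ← PiS_eq_sandwich]

/-! ## §2 The complement defect of the scalar propagator -/

/-- axis defects from gradient bounds on 0-forms: `‖(S_ν − 1)X‖ ≤ C/|c|` from `‖∂^c_νX‖ ≤ C`. [folklore] -/
theorem opNorm_shiftS_sub_one_mul_le {Nf : Fin d → ℕ} [∀ μ, NeZero (Nf μ)] {β : Type*} [Fintype β] [DecidableEq β]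
    (X : Matrix (Tor Nf) β ℂ) {c : ℂ} (hc : c ≠ 0) {C : ℝ} (ν : Fin d) (hX : ‖sdiff Nf c ν * X‖ ≤ C) :
    ‖(shiftS Nf ν - 1) * X‖ ≤ C / ‖c‖ := by
  have e : (shiftS Nf ν - 1) * X = c⁻¹ • (sdiff Nf c ν * X) := by
    rw [Literature.MathematicalPhysics.QuantumFieldTheory.Balaban1983to89.B5Action121.sdiff, Matrix.smul_mul, smul_smul,
      inv_mul_cancel₀ hc, one_smul]
  rw [e, norm_smul, norm_inv, div_eq_inv_mul]
  exact mul_le_mul_of_nonneg_left hX (inv_nonneg.mpr (norm_nonneg _))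

/-- **THE COMPLEMENT DEFECT OF THE SCALAR PROPAGATOR** (`d ≥ 1`, `a′ > 0`): `‖G′_{RN}·(1 − J₀J₀ᴴ)‖ ≤ 2d·√(γ′⁻¹)/N` — the finer massive
scalar propagator is `O(η)` off the planted functions. [folklore] -/
theorem opNorm_Gps_mul_one_sub_Pi0_le (hd : 0 < d) {a' : ℝ} (ha' : 0 < a') :
    ‖Gps (R * N) M a' * (1 - JK0 N R M * (JK0 N R M)ᴴ)‖ ≤ 2 * d * Real.sqrt ((gammaPs d a')⁻¹) / N := by
  have hR : (0 : ℝ) < R := by exact_mod_cast Nat.pos_of_ne_zero (NeZero.ne R)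
  have hN : (0 : ℝ) < N := by exact_mod_cast Nat.pos_of_ne_zero (NeZero.ne N)
  have hRN : ((R * N : ℕ) : ℂ) ≠ 0 := by exact_mod_cast (Nat.mul_ne_zero (NeZero.ne R) (NeZero.ne N))
  set δ : ℝ := Real.sqrt ((gammaPs d a')⁻¹) / ((R : ℝ) * N) with hδ
  have hδ0 : 0 ≤ δ := by positivity
  have hS : ∀ ν, ‖(shiftS (fine (R * N) M) ν - 1) * Gps (R * N) M a'‖ ≤ δ := by
    intro ν
    have h := opNorm_shiftS_sub_one_mul_le (Gps (R * N) M a') hRN ν (opNorm_sdiff_mul_Gps_le (R * N) M ha' ν)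
    have hn : ‖((R * N : ℕ) : ℂ)‖ = (R : ℝ) * N := by rw [Complex.norm_natCast]; push_cast; ring
    rwa [hn] at h
  have hP := opNorm_one_sub_Pi0_mul_le N R M hd (Gps (R * N) M a') hδ0 hS
  -- `‖G′(1 − Π₀)‖ = ‖(1 − Π₀)G′‖` (both Hermitian)
  have e : Gps (R * N) M a' * (1 - JK0 N R M * (JK0 N R M)ᴴ) = ((1 - Pi0 N R M) * Gps (R * N) M a')ᴴ := by
    rw [Matrix.conjTranspose_mul, (Gps_isHermitian (R * N) M a').eq, Matrix.conjTranspose_sub, Matrix.conjTranspose_one, Pi0_conjTranspose,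
      JK0_mul_conjTranspose]
  rw [e, Matrix.l2_opNorm_conjTranspose]
  refine hP.trans (le_of_eq ?_)
  rw [hδ]
  field_simp

end TwoLevel

/-! ## §3 Along the tower `n_k = L^k` -/

section TowerLevel

variable (L : ℕ) [NeZero L] (M : Fin d → ℕ) [hM : ∀ μ, NeZero (M μ)]

/-- the one-step 0-form averagings along the tower. [folklore] -/
def Q0lev (k : ℕ) : Matrix (Tor (fine (lev L k) M)) (Tor (fine (lev L (k + 1)) M)) ℂ := Qavg0 (lev L k) L M

/-- King's 0-form planting along the tower, between consecutive levels. [folklore] -/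
def J0pcT (k : ℕ) : Matrix (Tor (fine (lev L (k + 1)) M)) (Tor (fine (lev L k) M)) ℂ := JK0 (lev L k) L M

/-- `J₀ᴴJ₀ = 1` along the tower. [folklore] -/
theorem J0pcT_conjTranspose_mul_J0pcT (k : ℕ) : (J0pcT L M k)ᴴ * J0pcT L M k = 1 := JK0_conjTranspose_mul_JK0 (lev L k) L M

/-- `‖J₀‖ ≤ 1` along the tower. [folklore] -/
theorem opNorm_J0pcT_le (k : ℕ) : ‖J0pcT L M k‖ ≤ 1 := opNorm_JK0_le (lev L k) L M

/-- `‖Q₀‖² ≤ (L^d)⁻¹` along the tower. [folklore] -/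
theorem opNorm_Q0lev_sq_le (k : ℕ) : ‖Q0lev L M k‖ ^ 2 ≤ ((L : ℝ) ^ d)⁻¹ := opNorm_Qavg0_sq_le (lev L k) L M

/-- the pairing along the tower: `√(L^d)·Q₀J₀ = 1 + 0`. [folklore] -/
theorem sqrt_smul_Q0lev_mul_J0pcT (k : ℕ) :
    ((((Real.sqrt ((L : ℝ) ^ d)) : ℝ) : ℂ)) • (Q0lev L M k * J0pcT L M k) = 1 + 0 := sqrt_smul_Qavg0_mul_JK0 (lev L k) L M

/-- the scalar operators along the tower, in the `A + JBJᴴ` form. [folklore] -/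
theorem DeltaPs_succ_eq (a' : ℝ) (k : ℕ) :
    DeltaPs (lev L (k + 1)) M a' = LapS (fine (lev L (k + 1)) M) ((lev L (k + 1) : ℕ) : ℂ)
      + J0pcT L M k * ((a' : ℂ) • PiS (lev L k) M) * (J0pcT L M k)ᴴ :=
  DeltaPs_eq_sandwich (lev L k) L M a'

/-- the unit-block masses intertwine along the tower. [folklore] -/
theorem PiS_succ_mul_J0pcT (k : ℕ) : PiS (lev L (k + 1)) M * J0pcT L M k = J0pcT L M k * PiS (lev L k) M := PiS_mul_JK0 (lev L k) L M

/-- **the complement defect along the tower**: `‖G′_{k+1}(1 − J₀J₀ᴴ)‖ ≤ 2d·√(γ′⁻¹)·L^{−k}`. [folklore] -/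
theorem complement_le_lev0 (hd : 0 < d) {a' : ℝ} (ha' : 0 < a') (k : ℕ) :
    ‖(DeltaPs (lev L (k + 1)) M a')⁻¹ * (1 - J0pcT L M k * (J0pcT L M k)ᴴ)‖
      ≤ 2 * d * Real.sqrt ((gammaPs d a')⁻¹) * ((L : ℝ)⁻¹) ^ k := by
  have h := opNorm_Gps_mul_one_sub_Pi0_le (lev L k) L M hd ha'
  rw [cast_lev'] at h
  rw [inv_pow, ← div_eq_mul_inv]
  exact h

end TowerLevel

end Summit.QuantumFields.BalabanUV.T4Continuum.ScalarPlantingDefect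

end
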